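import Literature.NumberTheory.EllipticCurves.ZpExtensionEisensteinDVRSettingH4RestrictedAdjointProofs
import Literature.NumberTheory.GaloisCohomology.Howard2004.DualityDatumRestrictedPairingFlipNaturalityProofs
import HarnessLib

/-!
# H.4 at the places `v ∣ p` for the curve's Eisenstein setting, VII♭: reduction compatibility (hB♭) and the projection
# formulas (Adj♭), (Adj′♭) for the FLIPPED restricted pairings `W_j / Fil_v W_j × Fil′_j → A_{m,j}(1)` of the tower

`Proofs` file (theorems only; no definition, no named fact, no instance, no `sorry`).  The X/Y-flipped twin of x9-p1-w2's
`ZpExtensionEisensteinDVRSettingH4RestrictedAdjointProofs` ((hB-res)/(Adj-res)/(Adj′-res) for the restricted pairings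
`P_j (s, [t]) = e_j (s, t)`), for the flipped restricted pairings `P♭_j ([s], t) = e_j (s, t)` of
`Howard2004/DualityDatumRestrictedPairingFlipProofs` (`DualityDatum.exists_restrictedPairing_flip`; Eisenstein turnkey
`eisensteinTower_restrictedPairing_flip_nondegenerate`), via the generic `Howard2004/DualityDatumRestrictedPairingFlipNaturalityProofs`
and x9-p1-w2's module-level `e`-clauses `eisensteinTower_apply_e_transfer_redIter` / `eisensteinTower_apply_e_redIter_transfer`
(unchanged: the flip only swaps which side is the sub- and which the quotient representation).

In the rank-free proof of the SECOND (Exact) clause of Howard's H.4 for `F_𝔮` at `v ∣ p` (cell memo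
`HOME/p1/H4-EXACT-AT-P-PLAN-x10b-p1-g8.md` §1(c)–(f), (ANN-SAT-X)/(EXACT-X)) the limit right-kernel-torsion step
(x10b-p1-w8's `Tower.pow_smul_eq_zero_of_forall_pairing_eq_zero`) runs on the flipped PAIR of towers
`X_j = H¹(K_v, W_j / Fil_v W_j)`, `Y_j = H¹(K_v, Fil′_j)`.  For the curve's tower `W.eisensteinTower κ hm` and ANY H.4 data `D k`
over `A_{m,k+1}` with the reduction identity `he_red`, this file supplies the instantiated identities, for ANY `Γ_{K_v}`-stable
`V_j ≤ T^{(j)}`, `V′_j ≤ Tw T^{(j)}`, any flipped restricted pairings `P_j` with the characterising property, and any maps of the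
quotient and sub representations lying over the tower's iterated reduction `red^{(d)}` and division `F (k+1) (k+d+1)`:

* (hB♭-res) `eisensteinTower_restrictedPairing_flip_cupProduct_red` (one reduction step, `φ := reduce`, from `he_red`);
* (Adj♭-res) `eisensteinTower_restrictedPairing_flip_cupProduct_adjoint` (reduction on the quotient side, division on the sub
  side — the `hAdj` shape of `Tower.pow_smul_eq_zero_of_forall_pairing_eq_zero` for the flipped pair);
* (Adj′♭-res) `eisensteinTower_restrictedPairing_flip_cupProduct_adjoint'` (mirror).

Cell `pub/bsd-print-x9` (STUB A `hfin4` at `v ∣ p`, (Exact) brick (B6) inputs, (B3♭) lineage).  No summit statement is proved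
here; BSD is not proved by any of this.  Seat `bsd-line-x10b-p1-w7` g2.  References: [Howard2004HeegnerKolyvagin] §1.3 H.4
(arXiv:1202.6340 p. 7 L78–82), §1.6 (p. 11 L33–38), Lemma 3.1.1, Def. 3.2.5–3.2.6; [NeukirchSchmidtWingberg2008] I §4 (1.4.2)–(1.4.6);
[MilneADT2006] I Cor. 2.3.
-/

set_option autoImplicit false

noncomputable section

open Function NumberField IsDedekindDomain Field CategoryTheory
open scoped NumberField ContRepresentation

namespace WeierstrassCurve

open Literature.NumberTheory.EllipticCurves Literature.NumberTheory.GaloisRepresentations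
open Literature.NumberTheory.GaloisRepresentations.DiscreteGaloisModule
open Literature.NumberTheory.GaloisCohomology Literature.NumberTheory.GaloisCohomology.Howard2004
open Literature.NumberTheory.EllipticCurves.ZpExtension (EisensteinLevel)

variable {K : Type} [Field K] [NumberField K] (W : WeierstrassCurve ℚ) [W.IsElliptic] {p : ℕ} [hp : Fact p.Prime]
  (κ : ZpExtension K p) {m : ℕ} (hm : 1 ≤ m) (cd : ConjugationDatum K)
  (D : letI := IwasawaAlgebra.isLocalRing_quotient_X_pow_add_C p hm
    ∀ k, DualityDatum p cd ((W.eisensteinTower κ hm).ρ k) (IwasawaAlgebra.EisensteinCoeff p m (k + 1)))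
  (he_red : letI := IwasawaAlgebra.isLocalRing_quotient_X_pow_add_C p hm
    ∀ k (x y : EisensteinLevel p m (fun j ↦ geomTorsion (W.baseChange K) ((p : ℤ) ^ j)) (k + 1 + 1)),
      IwasawaAlgebra.EisensteinCoeff.reduce p m (Nat.le_succ (k + 1)) ((D (k + 1)).e x y) =
        (D k).e ((W.eisensteinTower κ hm).red k x) ((W.eisensteinTower κ hm).red k y))

/-! ## (hB♭-res), (Adj♭-res), (Adj′♭-res) for the flipped restricted pairings of the tower -/

include he_red in
/-- **(hB♭-res) one reduction step**: for flipped restricted pairings `P₁` at level `k+1` and `P₂` at level `k` (any stable `V`,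
`V′` and the characterising property `P ([s], t) = e (s, t)`), maps `u`, `r` of the quotient and sub representations lying over
the tower's reduction `red_k`, and `φ := reduce`: `H²(reduce(1)) (x ∪_{P₁} y) = H¹(u) x ∪_{P₂} H¹(r) y`.
[cite: Howard2004HeegnerKolyvagin, §1.6 (arXiv p. 11, L33–38), Lemma 3.1.1 and Def. 3.2.6] [cite: NeukirchSchmidtWingberg2008, I §4 (1.4.2)] -/
theorem eisensteinTower_restrictedPairing_flip_cupProduct_red (v : HeightOneSpectrum (𝓞 K)) [CharZero (v.adicCompletion K)] (k : ℕ)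
    {V₁ : letI := IwasawaAlgebra.isLocalRing_quotient_X_pow_add_C p hm
      Submodule ℤ (EisensteinLevel p m (fun j ↦ geomTorsion (W.baseChange K) ((p : ℤ) ^ j)) (k + 1 + 1))}
    {hV₁ : letI := IwasawaAlgebra.isLocalRing_quotient_X_pow_add_C p hm
      ∀ σ : absoluteGaloisGroup (v.adicCompletion K), V₁ ≤ V₁.comap (GaloisRep.toLocal v ((W.eisensteinTower κ hm).ρ (k + 1)) σ)}
    {V₁' : letI := IwasawaAlgebra.isLocalRing_quotient_X_pow_add_C p hm
      Submodule ℤ (EisensteinLevel p m (fun j ↦ geomTorsion (W.baseChange K) ((p : ℤ) ^ j)) (k + 1 + 1))}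
    {hV₁' : letI := IwasawaAlgebra.isLocalRing_quotient_X_pow_add_C p hm
      ∀ σ : absoluteGaloisGroup (v.adicCompletion K),
        V₁' ≤ V₁'.comap (GaloisRep.toLocal v (cd.twist ((W.eisensteinTower κ hm).ρ (k + 1))) σ)}
    {V₂ : letI := IwasawaAlgebra.isLocalRing_quotient_X_pow_add_C p hm
      Submodule ℤ (EisensteinLevel p m (fun j ↦ geomTorsion (W.baseChange K) ((p : ℤ) ^ j)) (k + 1))}
    {hV₂ : letI := IwasawaAlgebra.isLocalRing_quotient_X_pow_add_C p hm
      ∀ σ : absoluteGaloisGroup (v.adicCompletion K), V₂ ≤ V₂.comap (GaloisRep.toLocal v ((W.eisensteinTower κ hm).ρ k) σ)}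
    {V₂' : letI := IwasawaAlgebra.isLocalRing_quotient_X_pow_add_C p hm
      Submodule ℤ (EisensteinLevel p m (fun j ↦ geomTorsion (W.baseChange K) ((p : ℤ) ^ j)) (k + 1))}
    {hV₂' : letI := IwasawaAlgebra.isLocalRing_quotient_X_pow_add_C p hm
      ∀ σ : absoluteGaloisGroup (v.adicCompletion K),
        V₂' ≤ V₂'.comap (GaloisRep.toLocal v (cd.twist ((W.eisensteinTower κ hm).ρ k)) σ)}
    (P₁ : letI := IwasawaAlgebra.isLocalRing_quotient_X_pow_add_C p hm
      ContPairing ((GaloisRep.toLocal v ((W.eisensteinTower κ hm).ρ (k + 1))).quotient V₁ hV₁).toTopRep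
        ((GaloisRep.toLocal v (cd.twist ((W.eisensteinTower κ hm).ρ (k + 1)))).subrepresentation V₁' hV₁').toTopRep
        (GaloisRep.toLocal v (D (k + 1)).twistOne).toTopRep)
    (hP₁ : ∀ (s) (t : V₁'), P₁.toLin (Submodule.Quotient.mk s) t = (D (k + 1)).e s (t : _))
    (P₂ : letI := IwasawaAlgebra.isLocalRing_quotient_X_pow_add_C p hm
      ContPairing ((GaloisRep.toLocal v ((W.eisensteinTower κ hm).ρ k)).quotient V₂ hV₂).toTopRep
        ((GaloisRep.toLocal v (cd.twist ((W.eisensteinTower κ hm).ρ k))).subrepresentation V₂' hV₂').toTopRep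
        (GaloisRep.toLocal v (D k).twistOne).toTopRep)
    (hP₂ : ∀ (s) (t : V₂'), P₂.toLin (Submodule.Quotient.mk s) t = (D k).e s (t : _))
    (u : letI := IwasawaAlgebra.isLocalRing_quotient_X_pow_add_C p hm
      ((GaloisRep.toLocal v ((W.eisensteinTower κ hm).ρ (k + 1))).quotient V₁ hV₁).toContRepresentation →ⁱL
        ((GaloisRep.toLocal v ((W.eisensteinTower κ hm).ρ k)).quotient V₂ hV₂).toContRepresentation)
    (hu : letI := IwasawaAlgebra.isLocalRing_quotient_X_pow_add_C p hm
      ∀ s, u (Submodule.Quotient.mk s) = Submodule.Quotient.mk ((W.eisensteinTower κ hm).red k s))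
    (r : letI := IwasawaAlgebra.isLocalRing_quotient_X_pow_add_C p hm
      ((GaloisRep.toLocal v (cd.twist ((W.eisensteinTower κ hm).ρ (k + 1)))).subrepresentation V₁' hV₁').toContRepresentation →ⁱL
        ((GaloisRep.toLocal v (cd.twist ((W.eisensteinTower κ hm).ρ k))).subrepresentation V₂' hV₂').toContRepresentation)
    (hr : letI := IwasawaAlgebra.isLocalRing_quotient_X_pow_add_C p hm
      ∀ t : V₁', ((r t : V₂') : _) = (W.eisensteinTower κ hm).red k (t : _))
    (x : letI := IwasawaAlgebra.isLocalRing_quotient_X_pow_add_C p hm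
      galoisCohomology ((GaloisRep.toLocal v ((W.eisensteinTower κ hm).ρ (k + 1))).quotient V₁ hV₁) 1)
    (y : letI := IwasawaAlgebra.isLocalRing_quotient_X_pow_add_C p hm
      galoisCohomology ((GaloisRep.toLocal v (cd.twist ((W.eisensteinTower κ hm).ρ (k + 1)))).subrepresentation V₁' hV₁') 1) :
    letI := IwasawaAlgebra.isLocalRing_quotient_X_pow_add_C p hm
    ContinuousRep.cohomologyMap (GaloisRep.toLocal v (D (k + 1)).twistOne) (GaloisRep.toLocal v (D k).twistOne)
        (IwasawaAlgebra.EisensteinCoeff.reduce p m (Nat.le_succ (k + 1))).toAddMonoidHom continuous_of_discreteTopology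
        (fun _ z => W.reduce_twistOne κ hm cd D k _ z) 2 (P₁.cupProduct x y) =
      P₂.cupProduct (galoisCohomology.map u 1 x) (galoisCohomology.map r 1 y) := by
  letI := IwasawaAlgebra.isLocalRing_quotient_X_pow_add_C p hm
  exact (D (k + 1)).restrictedPairing_flip_cupProduct_map (D k) v P₁ hP₁ P₂ hP₂ _ (fun g z => W.reduce_twistOne κ hm cd D k g z)
    u ((W.eisensteinTower κ hm).red k).toAddMonoidHom hu r ((W.eisensteinTower κ hm).red k).toAddMonoidHom hr
    (fun s t => he_red k s t) x y

include he_red in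
/-- **(Adj♭-res)**: for flipped restricted pairings `P₁` at level `k` and `P₂` at level `k+d` (any stable `V`, `V′`,
characterising property), `u : T^{(k+d)}/V → T^{(k)}/V` over the iterated reduction `red^{(d)}`, `r : Fil′_k → Fil′_{k+d}` over the
division `F (k+1) (k+d+1)`, and ANY value map `ι_d` with `ι_d ∘ reduce = p^d ·`:
`H²(ι_d(1)) (H¹(u) w ∪_{P₁} y) = w ∪_{P₂} H¹(r) y` — the `hAdj` shape of `Tower.pow_smul_eq_zero_of_forall_pairing_eq_zero` for the
flipped pair `(H¹(K_v, T/V), H¹(K_v, Fil′))`. [cite: Howard2004HeegnerKolyvagin, §1.3 H.4 (arXiv p. 7, L78–82), §1.6 (p. 11 L33–38), Def. 3.2.6]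
[cite: NeukirchSchmidtWingberg2008, I §4 (1.4.2)–(1.4.6)] -/
theorem eisensteinTower_restrictedPairing_flip_cupProduct_adjoint (v : HeightOneSpectrum (𝓞 K)) [CharZero (v.adicCompletion K)]
    (k d : ℕ)
    (ι : IwasawaAlgebra.EisensteinCoeff p m (k + 1) →+ IwasawaAlgebra.EisensteinCoeff p m (k + d + 1))
    (hι : ∀ x : IwasawaAlgebra.EisensteinCoeff p m (k + d + 1),
      ι (IwasawaAlgebra.EisensteinCoeff.reduce p m (Nat.succ_le_succ (Nat.le_add_right k d)) x) = p ^ d • x)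
    {V₁ : letI := IwasawaAlgebra.isLocalRing_quotient_X_pow_add_C p hm
      Submodule ℤ (EisensteinLevel p m (fun j ↦ geomTorsion (W.baseChange K) ((p : ℤ) ^ j)) (k + 1))}
    {hV₁ : letI := IwasawaAlgebra.isLocalRing_quotient_X_pow_add_C p hm
      ∀ σ : absoluteGaloisGroup (v.adicCompletion K), V₁ ≤ V₁.comap (GaloisRep.toLocal v ((W.eisensteinTower κ hm).ρ (k)) σ)}
    {V₁' : letI := IwasawaAlgebra.isLocalRing_quotient_X_pow_add_C p hm
      Submodule ℤ (EisensteinLevel p m (fun j ↦ geomTorsion (W.baseChange K) ((p : ℤ) ^ j)) (k + 1))}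
    {hV₁' : letI := IwasawaAlgebra.isLocalRing_quotient_X_pow_add_C p hm
      ∀ σ : absoluteGaloisGroup (v.adicCompletion K),
        V₁' ≤ V₁'.comap (GaloisRep.toLocal v (cd.twist ((W.eisensteinTower κ hm).ρ (k))) σ)}
    {V₂ : letI := IwasawaAlgebra.isLocalRing_quotient_X_pow_add_C p hm
      Submodule ℤ (EisensteinLevel p m (fun j ↦ geomTorsion (W.baseChange K) ((p : ℤ) ^ j)) (k + d + 1))}
    {hV₂ : letI := IwasawaAlgebra.isLocalRing_quotient_X_pow_add_C p hm
      ∀ σ : absoluteGaloisGroup (v.adicCompletion K), V₂ ≤ V₂.comap (GaloisRep.toLocal v ((W.eisensteinTower κ hm).ρ (k + d)) σ)}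
    {V₂' : letI := IwasawaAlgebra.isLocalRing_quotient_X_pow_add_C p hm
      Submodule ℤ (EisensteinLevel p m (fun j ↦ geomTorsion (W.baseChange K) ((p : ℤ) ^ j)) (k + d + 1))}
    {hV₂' : letI := IwasawaAlgebra.isLocalRing_quotient_X_pow_add_C p hm
      ∀ σ : absoluteGaloisGroup (v.adicCompletion K),
        V₂' ≤ V₂'.comap (GaloisRep.toLocal v (cd.twist ((W.eisensteinTower κ hm).ρ (k + d))) σ)}
    (P₁ : letI := IwasawaAlgebra.isLocalRing_quotient_X_pow_add_C p hm
      ContPairing ((GaloisRep.toLocal v ((W.eisensteinTower κ hm).ρ (k))).quotient V₁ hV₁).toTopRep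
        ((GaloisRep.toLocal v (cd.twist ((W.eisensteinTower κ hm).ρ (k)))).subrepresentation V₁' hV₁').toTopRep
        (GaloisRep.toLocal v (D (k)).twistOne).toTopRep)
    (hP₁ : ∀ (s) (t : V₁'), P₁.toLin (Submodule.Quotient.mk s) t = (D (k)).e s (t : _))
    (P₂ : letI := IwasawaAlgebra.isLocalRing_quotient_X_pow_add_C p hm
      ContPairing ((GaloisRep.toLocal v ((W.eisensteinTower κ hm).ρ (k + d))).quotient V₂ hV₂).toTopRep
        ((GaloisRep.toLocal v (cd.twist ((W.eisensteinTower κ hm).ρ (k + d)))).subrepresentation V₂' hV₂').toTopRep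
        (GaloisRep.toLocal v (D (k + d)).twistOne).toTopRep)
    (hP₂ : ∀ (s) (t : V₂'), P₂.toLin (Submodule.Quotient.mk s) t = (D (k + d)).e s (t : _))
    (u : letI := IwasawaAlgebra.isLocalRing_quotient_X_pow_add_C p hm
      ((GaloisRep.toLocal v ((W.eisensteinTower κ hm).ρ (k + d))).quotient V₂ hV₂).toContRepresentation →ⁱL
        ((GaloisRep.toLocal v ((W.eisensteinTower κ hm).ρ k)).quotient V₁ hV₁).toContRepresentation)
    (hu : letI := IwasawaAlgebra.isLocalRing_quotient_X_pow_add_C p hm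
      ∀ s, u (Submodule.Quotient.mk s) = Submodule.Quotient.mk ((W.eisensteinTower κ hm).redIter k d s))
    (r : letI := IwasawaAlgebra.isLocalRing_quotient_X_pow_add_C p hm
      ((GaloisRep.toLocal v (cd.twist ((W.eisensteinTower κ hm).ρ k))).subrepresentation V₁' hV₁').toContRepresentation →ⁱL
        ((GaloisRep.toLocal v (cd.twist ((W.eisensteinTower κ hm).ρ (k + d)))).subrepresentation V₂' hV₂').toContRepresentation)
    (hr : letI := IwasawaAlgebra.isLocalRing_quotient_X_pow_add_C p hm
      ∀ t : V₁', ((r t : V₂') : EisensteinLevel p m (fun j ↦ geomTorsion (W.baseChange K) ((p : ℤ) ^ j)) (k + d + 1)) =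
        (W.baseChange K).eisensteinTwistTorsionTransfer κ hm
          (fun j ↦ (W.baseChange K).torsionGaloisModuleReduce p j) (W.torsionGaloisModuleReduce_coe (K := K) (p := p))
          (k + 1) (k + d + 1)
          ((t : EisensteinLevel p m (fun j ↦ geomTorsion (W.baseChange K) ((p : ℤ) ^ j)) (k + 1)) :
            IwasawaAlgebra.EisensteinCoeff.Twisted p m (k + 1) (geomTorsion (W.baseChange K) ((p : ℤ) ^ (k + 1)))))
    (w : letI := IwasawaAlgebra.isLocalRing_quotient_X_pow_add_C p hm
      galoisCohomology ((GaloisRep.toLocal v ((W.eisensteinTower κ hm).ρ (k + d))).quotient V₂ hV₂) 1)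
    (y : letI := IwasawaAlgebra.isLocalRing_quotient_X_pow_add_C p hm
      galoisCohomology ((GaloisRep.toLocal v (cd.twist ((W.eisensteinTower κ hm).ρ k))).subrepresentation V₁' hV₁') 1) :
    letI := IwasawaAlgebra.isLocalRing_quotient_X_pow_add_C p hm
    ContinuousRep.cohomologyMap (GaloisRep.toLocal v (D k).twistOne) (GaloisRep.toLocal v (D (k + d)).twistOne) ι
        continuous_of_discreteTopology
        (fun _ z => (D k).twistOne_apply_of_apply_reduce (D (k + d)) _ ι (p ^ d) hι _ z) 2
        (P₁.cupProduct (galoisCohomology.map u 1 w) y) =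
      P₂.cupProduct w (galoisCohomology.map r 1 y) := by
  letI := IwasawaAlgebra.isLocalRing_quotient_X_pow_add_C p hm
  exact (D k).restrictedPairing_flip_cupProduct_map_adjoint (D (k + d)) v P₁ hP₁ P₂ hP₂ ι
    (fun g z => (D k).twistOne_apply_of_apply_reduce (D (k + d)) _ ι (p ^ d) hι g z)
    u ((W.eisensteinTower κ hm).redIter k d).toAddMonoidHom hu r
    (((W.baseChange K).eisensteinTwistTorsionTransfer κ hm
          (fun j ↦ (W.baseChange K).torsionGaloisModuleReduce p j) (W.torsionGaloisModuleReduce_coe (K := K) (p := p))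
          (k + 1) (k + d + 1)).toContinuousLinearMap.toLinearMap.toAddMonoidHom) hr
    (fun s' t' => W.eisensteinTower_apply_e_redIter_transfer κ hm cd D he_red k d ι hι s' t') w y

include he_red in
/-- **(Adj′♭-res)** (mirror variance): `u : T^{(k)}/V → T^{(k+d)}/V` over the division `F (k+1) (k+d+1)`, `r : Fil′_{k+d} → Fil′_k`
over the iterated reduction `red^{(d)}`, ANY `ι_d` with `ι_d ∘ reduce = p^d ·`:
`H²(ι_d(1)) (x ∪_{P₁} H¹(r) w) = H¹(u) x ∪_{P₂} w`. [cite: Howard2004HeegnerKolyvagin, §1.3 H.4 (arXiv p. 7, L78–82), §1.6 (p. 11 L33–38), Def. 3.2.6]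
[cite: NeukirchSchmidtWingberg2008, I §4 (1.4.2)–(1.4.6)] -/
theorem eisensteinTower_restrictedPairing_flip_cupProduct_adjoint' (v : HeightOneSpectrum (𝓞 K)) [CharZero (v.adicCompletion K)]
    (k d : ℕ)
    (ι : IwasawaAlgebra.EisensteinCoeff p m (k + 1) →+ IwasawaAlgebra.EisensteinCoeff p m (k + d + 1))
    (hι : ∀ x : IwasawaAlgebra.EisensteinCoeff p m (k + d + 1),
      ι (IwasawaAlgebra.EisensteinCoeff.reduce p m (Nat.succ_le_succ (Nat.le_add_right k d)) x) = p ^ d • x)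
    {V₁ : letI := IwasawaAlgebra.isLocalRing_quotient_X_pow_add_C p hm
      Submodule ℤ (EisensteinLevel p m (fun j ↦ geomTorsion (W.baseChange K) ((p : ℤ) ^ j)) (k + 1))}
    {hV₁ : letI := IwasawaAlgebra.isLocalRing_quotient_X_pow_add_C p hm
      ∀ σ : absoluteGaloisGroup (v.adicCompletion K), V₁ ≤ V₁.comap (GaloisRep.toLocal v ((W.eisensteinTower κ hm).ρ (k)) σ)}
    {V₁' : letI := IwasawaAlgebra.isLocalRing_quotient_X_pow_add_C p hm
      Submodule ℤ (EisensteinLevel p m (fun j ↦ geomTorsion (W.baseChange K) ((p : ℤ) ^ j)) (k + 1))}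
    {hV₁' : letI := IwasawaAlgebra.isLocalRing_quotient_X_pow_add_C p hm
      ∀ σ : absoluteGaloisGroup (v.adicCompletion K),
        V₁' ≤ V₁'.comap (GaloisRep.toLocal v (cd.twist ((W.eisensteinTower κ hm).ρ (k))) σ)}
    {V₂ : letI := IwasawaAlgebra.isLocalRing_quotient_X_pow_add_C p hm
      Submodule ℤ (EisensteinLevel p m (fun j ↦ geomTorsion (W.baseChange K) ((p : ℤ) ^ j)) (k + d + 1))}
    {hV₂ : letI := IwasawaAlgebra.isLocalRing_quotient_X_pow_add_C p hm
      ∀ σ : absoluteGaloisGroup (v.adicCompletion K), V₂ ≤ V₂.comap (GaloisRep.toLocal v ((W.eisensteinTower κ hm).ρ (k + d)) σ)}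
    {V₂' : letI := IwasawaAlgebra.isLocalRing_quotient_X_pow_add_C p hm
      Submodule ℤ (EisensteinLevel p m (fun j ↦ geomTorsion (W.baseChange K) ((p : ℤ) ^ j)) (k + d + 1))}
    {hV₂' : letI := IwasawaAlgebra.isLocalRing_quotient_X_pow_add_C p hm
      ∀ σ : absoluteGaloisGroup (v.adicCompletion K),
        V₂' ≤ V₂'.comap (GaloisRep.toLocal v (cd.twist ((W.eisensteinTower κ hm).ρ (k + d))) σ)}
    (P₁ : letI := IwasawaAlgebra.isLocalRing_quotient_X_pow_add_C p hm
      ContPairing ((GaloisRep.toLocal v ((W.eisensteinTower κ hm).ρ (k))).quotient V₁ hV₁).toTopRep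
        ((GaloisRep.toLocal v (cd.twist ((W.eisensteinTower κ hm).ρ (k)))).subrepresentation V₁' hV₁').toTopRep
        (GaloisRep.toLocal v (D (k)).twistOne).toTopRep)
    (hP₁ : ∀ (s) (t : V₁'), P₁.toLin (Submodule.Quotient.mk s) t = (D (k)).e s (t : _))
    (P₂ : letI := IwasawaAlgebra.isLocalRing_quotient_X_pow_add_C p hm
      ContPairing ((GaloisRep.toLocal v ((W.eisensteinTower κ hm).ρ (k + d))).quotient V₂ hV₂).toTopRep
        ((GaloisRep.toLocal v (cd.twist ((W.eisensteinTower κ hm).ρ (k + d)))).subrepresentation V₂' hV₂').toTopRep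
        (GaloisRep.toLocal v (D (k + d)).twistOne).toTopRep)
    (hP₂ : ∀ (s) (t : V₂'), P₂.toLin (Submodule.Quotient.mk s) t = (D (k + d)).e s (t : _))
    (u : letI := IwasawaAlgebra.isLocalRing_quotient_X_pow_add_C p hm
      ((GaloisRep.toLocal v ((W.eisensteinTower κ hm).ρ k)).quotient V₁ hV₁).toContRepresentation →ⁱL
        ((GaloisRep.toLocal v ((W.eisensteinTower κ hm).ρ (k + d))).quotient V₂ hV₂).toContRepresentation)
    (hu : letI := IwasawaAlgebra.isLocalRing_quotient_X_pow_add_C p hm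
      ∀ s, u (Submodule.Quotient.mk s) = Submodule.Quotient.mk
        ((W.baseChange K).eisensteinTwistTorsionTransfer κ hm
          (fun j ↦ (W.baseChange K).torsionGaloisModuleReduce p j) (W.torsionGaloisModuleReduce_coe (K := K) (p := p))
          (k + 1) (k + d + 1)
          (s : IwasawaAlgebra.EisensteinCoeff.Twisted p m (k + 1) (geomTorsion (W.baseChange K) ((p : ℤ) ^ (k + 1))))))
    (r : letI := IwasawaAlgebra.isLocalRing_quotient_X_pow_add_C p hm
      ((GaloisRep.toLocal v (cd.twist ((W.eisensteinTower κ hm).ρ (k + d)))).subrepresentation V₂' hV₂').toContRepresentation →ⁱL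
        ((GaloisRep.toLocal v (cd.twist ((W.eisensteinTower κ hm).ρ k))).subrepresentation V₁' hV₁').toContRepresentation)
    (hr : letI := IwasawaAlgebra.isLocalRing_quotient_X_pow_add_C p hm
      ∀ t : V₂', ((r t : V₁') : _) = (W.eisensteinTower κ hm).redIter k d (t : _))
    (x : letI := IwasawaAlgebra.isLocalRing_quotient_X_pow_add_C p hm
      galoisCohomology ((GaloisRep.toLocal v ((W.eisensteinTower κ hm).ρ k)).quotient V₁ hV₁) 1)
    (w : letI := IwasawaAlgebra.isLocalRing_quotient_X_pow_add_C p hm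
      galoisCohomology ((GaloisRep.toLocal v (cd.twist ((W.eisensteinTower κ hm).ρ (k + d)))).subrepresentation V₂' hV₂') 1) :
    letI := IwasawaAlgebra.isLocalRing_quotient_X_pow_add_C p hm
    ContinuousRep.cohomologyMap (GaloisRep.toLocal v (D k).twistOne) (GaloisRep.toLocal v (D (k + d)).twistOne) ι
        continuous_of_discreteTopology
        (fun _ z => (D k).twistOne_apply_of_apply_reduce (D (k + d)) _ ι (p ^ d) hι _ z) 2
        (P₁.cupProduct x (galoisCohomology.map r 1 w)) =
      P₂.cupProduct (galoisCohomology.map u 1 x) w := by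
  letI := IwasawaAlgebra.isLocalRing_quotient_X_pow_add_C p hm
  exact (D k).restrictedPairing_flip_cupProduct_map_adjoint' (D (k + d)) v P₁ hP₁ P₂ hP₂ ι
    (fun g z => (D k).twistOne_apply_of_apply_reduce (D (k + d)) _ ι (p ^ d) hι g z)
    u (((W.baseChange K).eisensteinTwistTorsionTransfer κ hm
          (fun j ↦ (W.baseChange K).torsionGaloisModuleReduce p j) (W.torsionGaloisModuleReduce_coe (K := K) (p := p))
          (k + 1) (k + d + 1)).toContinuousLinearMap.toLinearMap.toAddMonoidHom) hu r
    ((W.eisensteinTower κ hm).redIter k d).toAddMonoidHom hr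
    (fun s' t' => W.eisensteinTower_apply_e_transfer_redIter κ hm cd D he_red k d ι hι s' t') x w

end WeierstrassCurve

end
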